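import Summits.MatrixMultiplication.MatrixMultiplication.Theorems.BoundedExponentThird.Negative.TwoLegBound
import Literature.Barriers.MatrixMultiplication.TricoloredSumFreeBarrier

/-!
# `BoundedExponentThird` (crux stmt-MatrixMultiplication-10596, route ThinBlockAlpha):
# coherent families certify nothing

Negative-side support file of the crux disprover (cdisprove seat); `sorry`-free.

* `sum_card_mul_le_of_coset_legs` — if every leg set `C i − A i` is a coset of ONE finite subgroup
  `V` (linear designs in `𝔽_pⁿ` with a common leg space), the `(B,C)`-translation mechanism makes
  the `V`-cosets `b − a_k − U_k` (`b ∈ B k`) pairwise distinct over all `(k, b)`: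
  `(Σ_k |B k|)·|V| ≤ |H|`, i.e. `L N² M ≤ |H|`; `not_BoundedExponentThirdCosetLegs`.
* `card_mul_le_of_translate_first` / `_third` — if ONE outer family consists of translates of a
  single set (`A i = A₀ + x i`, resp. `C i = C₀ + z i`), then already `L·N·M·N ≤ |H|`
  (injectivity of `((k,b,c),a₀) ↦ (b − c) + a₀`); `not_BoundedExponentThirdTranslateA`.
  With `TwoLegBound.card_mul_le_of_common_middle`: in a witness of the crux NONE of the three
  families `A, B, C` is a family of translates of one set.
-/

namespace Summit.MatrixMultiplication.MatrixMultiplication.Theorems.BoundedExponentThird.Negative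

open Finset Literature.Computability.AlgebraicComplexity
open Summit.MatrixMultiplication.MatrixMultiplication.Theses.ThinBlockAlpha (BoundedExponentThird)

/-! ## §3b  Coherent LEG sets certify nothing either -/

section CosetLegs

variable {H : Type*} [AddCommGroup H] [Fintype H] [DecidableEq H] {L : ℕ} {A B C : Fin L → Finset H}

/-- **Coset leg sets cost the full middle factor.** If every leg set `U i = C i − A i` is a
translate `x i + V` of ONE finite subgroup `V` (a finset containing `0`, closed under
subtraction) — e.g. "linear" designs in `𝔽_pⁿ` whose blocks are affine subspaces with a common
leg space `(A i − A i) ⊕ (C i − C i) = V` — then `(Σ_k |B k|) · |V| ≤ |H|`, i.e. `L M N² ≤ |H|`.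
Mechanism: the `(B, C)`-translation structure makes the `V`-cosets `b − a_k − U_k`, `b ∈ B k`,
pairwise distinct over ALL pairs `(k, b)` (each contains `b − c ∈ B k − C k`, and lies inside
`(B i − C i) + (A i − A i)` when read in block `i`). -/
theorem sum_card_mul_le_of_coset_legs (h : IsSTPP A B C) (V : Finset H) (hV0 : (0 : H) ∈ V)
    (hVsub : ∀ v ∈ V, ∀ w ∈ V, v - w ∈ V) (x : Fin L → H)
    (hUmem : ∀ k (y : H), y ∈ legSet A C k ↔ y - x k ∈ V) (hAne : ∀ i, (A i).Nonempty)
    (hCne : ∀ i, (C i).Nonempty) :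
    (∑ k, (B k).card) * V.card ≤ Fintype.card H := by
  choose a ha using hAne
  have hVneg : ∀ v ∈ V, -v ∈ V := fun v hv => by simpa using hVsub 0 hV0 v hv
  have hVadd : ∀ v ∈ V, ∀ w ∈ V, v + w ∈ V := fun v hv w hw => by
    simpa using hVsub v hv (-w) (hVneg w hw)
  -- the cosets `X k b = (b - a k) - U k`
  let X : Fin L → H → Finset H := fun k b => V.image fun v => (b - a k - x k) + v
  have hmemX : ∀ k b (y : H), y ∈ X k b ↔ y - (b - a k - x k) ∈ V := by
    intro k b y
    simp only [X, mem_image]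
    constructor
    · rintro ⟨v, hv, rfl⟩; simpa using hv
    · intro hy; exact ⟨_, hy, by abel⟩
  -- (i) `b - c ∈ X k b` for `c ∈ C k`
  have hbc : ∀ k, ∀ b, ∀ c ∈ C k, b - c ∈ X k b := by
    intro k b c hc
    rw [hmemX]
    have : c - a k ∈ legSet A C k := mem_legSet.2 ⟨a k, ha k, c, hc, rfl⟩
    rw [hUmem] at this
    have := hVneg _ this
    convert this using 1; abel
  -- (ii) elements of `X i b'` are `(b' - c') + (a' - a i)` with `a' ∈ A i`, `c' ∈ C i`
  have hXsub : ∀ i b', ∀ y ∈ X i b', ∃ a' ∈ A i, ∃ c' ∈ C i, y = (b' - c') + (a' - a i) := by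
    intro i b' y hy
    rw [hmemX] at hy
    have : b' - a i - y ∈ legSet A C i := by
      rw [hUmem]
      have := hVneg _ hy
      convert this using 1; abel
    obtain ⟨a', ha', c', hc', he⟩ := mem_legSet.1 this
    refine ⟨a', ha', c', hc', ?_⟩
    have e : y = b' - a i - (c' - a') := by rw [he]; abel
    rw [e]; abel
  -- two cosets that meet are nested (hence equal)
  have hXeq : ∀ k b i b', ¬ Disjoint (X k b) (X i b') → X k b ⊆ X i b' := by
    intro k b i b' hnd y hy
    obtain ⟨z, hz1, hz2⟩ := not_disjoint_iff.1 hnd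
    rw [hmemX] at hy hz1 hz2 ⊢
    have := hVadd _ hz2 _ (hVsub _ hy _ hz1)
    convert this using 1; abel
  -- pairwise disjointness over all pairs `(k, b)`, `b ∈ B k`
  have hdisj : ∀ k b, b ∈ B k → ∀ i b', b' ∈ B i → (k ≠ i ∨ b ≠ b') →
      Disjoint (X k b) (X i b') := by
    intro k b hb i b' hb' hne
    by_contra hnd
    have hsub := hXeq k b i b' hnd
    obtain ⟨c, hc⟩ := hCne k
    obtain ⟨a', ha', c', hc', he⟩ := hXsub i b' _ (hsub (hbc k b c hc))
    -- `he : b - c = (b' - c') + (a' - a i)`; STPP instance `(i, k, i)`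
    have e2 : (a i - a') + (b - b') + (c' - c) = (b - c) - ((b' - c') + (a' - a i)) := by abel
    have key := h i k i a' ha' (a i) (ha i) b' hb' b hb c hc c' hc' (by rw [e2, he, sub_self])
    rcases hne with hki | hbb
    · exact hki key.1.symm
    · exact hbb key.2.2.2.1.symm
  -- count: `(⟨k, b⟩, v) ↦ (b - a k - x k) + v` is injective on `(Σ k, B k) × V`
  let S : Finset ((Σ _ : Fin L, H) × H) := (Finset.univ.sigma fun k => B k) ×ˢ V
  have hinj : Set.InjOn (fun q : (Σ _ : Fin L, H) × H => (q.1.2 - a q.1.1 - x q.1.1) + q.2) ↑S := by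
    rintro ⟨⟨k, b⟩, v⟩ hq ⟨⟨i, b'⟩, v'⟩ hq' (he : (b - a k - x k) + v = (b' - a i - x i) + v')
    simp only [S, coe_product, coe_sigma, Set.mem_prod, Set.mem_sigma_iff, coe_univ,
      Set.mem_univ, true_and, mem_coe] at hq hq'
    have hy : (b - a k - x k) + v ∈ X k b := mem_image_of_mem _ hq.2
    have hy' : (b - a k - x k) + v ∈ X i b' := by rw [he]; exact mem_image_of_mem _ hq'.2
    have hnd : ¬ Disjoint (X k b) (X i b') := not_disjoint_iff.2 ⟨_, hy, hy'⟩
    have hki : k = i := by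
      by_contra hki; exact hnd (hdisj k b hq.1 i b' hq'.1 (Or.inl hki))
    subst hki
    have hbb : b = b' := by
      by_contra hbb; exact hnd (hdisj k b hq.1 k b' hq'.1 (Or.inr hbb))
    subst hbb
    have hvv : v = v' := add_left_cancel he
    subst hvv
    rfl
  have hS : S.card = (∑ k, (B k).card) * V.card := by
    simp only [S, card_product, card_sigma]
  rw [← hS]
  exact le_trans (card_le_card_of_injOn _ (fun _ _ => mem_univ _) hinj) (card_univ (α := H)).le

/-- NATURAL STRENGTHENING: the crux with leg sets `C i − A i` all cosets of one subgroup `V`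
(stated without `Finset.image`: membership in `C i − A i` is `· − x i ∈ V`). -/
def BoundedExponentThirdCosetLegs : Prop :=
  ∃ ℓ : ℕ, ∀ η : ℝ, 0 < η → ∃ (H : Type) (_ : AddCommGroup H) (_ : Fintype H) (L N M : ℕ)
    (A B C : Fin L → Finset H) (V : Finset H) (x : Fin L → H),
    ((0 : H) ∈ V ∧ (∀ v ∈ V, ∀ w ∈ V, v - w ∈ V) ∧
      ∀ i (y : H), (∃ a ∈ A i, ∃ c ∈ C i, c - a = y) ↔ y - x i ∈ V) ∧
    AddMonoid.exponent H ≤ ℓ ∧ IsSTPP A B C ∧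
    (∀ i, (A i).card = N ∧ (B i).card = M ∧ (C i).card = N) ∧ 2 ≤ N ∧
    (N : ℝ) ^ (1 / 3 : ℝ) ≤ M ∧ (Fintype.card H : ℝ) ≤ L * (N : ℝ) ^ (2 + η)

/-- It is a strengthening of the crux. -/
theorem cosetLegs_imp : BoundedExponentThirdCosetLegs → BoundedExponentThird := by
  rintro ⟨ℓ, h⟩
  refine ⟨ℓ, fun η hη => ?_⟩
  obtain ⟨H, i1, i2, L, N, M, A, B, C, -, -, -, rest⟩ := h η hη
  exact ⟨H, i1, i2, L, N, M, A, B, C, rest⟩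

/-- **Refuted strengthening:** coset leg sets give `L N² M ≤ |H|` (`sum_card_mul_le_of_coset_legs`),
incompatible with two-leg slack `N^η`, `η < 1/3`.  Linear designs with a common leg space are out;
witnesses need leg sets with INCOHERENT stabilisers (cf. the parallel-`U` example in §5). -/
theorem not_BoundedExponentThirdCosetLegs : ¬ BoundedExponentThirdCosetLegs := by
  rintro ⟨ℓ, h⟩
  obtain ⟨H, i1, i2, L, N, M, A, B, C, V, x, ⟨hV0, hVsub, hUV⟩, -, hS, hc, hN, hM, hH⟩ :=
    h (1 / 6) (by norm_num)
  classical
  have hL : 0 < L := blocks_pos hH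
  have hAne : ∀ i, (A i).Nonempty := fun i => card_pos.1 (by rw [(hc i).1]; omega)
  have hBne : ∀ i, (B i).Nonempty := fun i =>
    card_pos.1 (by rw [(hc i).2.1]; have := two_le_middle hN hM; omega)
  have hCne : ∀ i, (C i).Nonempty := fun i => card_pos.1 (by rw [(hc i).2.2]; omega)
  have hUmem : ∀ k (y : H), y ∈ legSet A C k ↔ y - x k ∈ V := fun k y => by
    rw [mem_legSet]; exact hUV k y
  -- `|V| = N²`
  have hVc : V.card = N * N := by
    have e : legSet A C ⟨0, hL⟩ = V.image (x ⟨0, hL⟩ + ·) := by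
      ext y
      rw [hUmem, mem_image]
      constructor
      · intro hy; exact ⟨_, hy, by abel⟩
      · rintro ⟨v, hv, rfl⟩; simpa using hv
    rw [← card_image_of_injective V (add_right_injective (x ⟨0, hL⟩)), ← e,
      card_legSet hS (hBne _), (hc _).1, (hc _).2.2]
  have key := sum_card_mul_le_of_coset_legs hS V hV0 hVsub x hUmem hAne hCne
  simp only [hc, sum_const, card_univ, Fintype.card_fin, smul_eq_mul, hVc] at key
  exact false_of_volume_bound hL hN hM (by simpa [mul_comm, mul_assoc, mul_left_comm] using key) hH

end CosetLegs

/-! ## §3c  One translate-coherent OUTER family already certifies nothing -/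

section TranslateOuter

variable {H : Type*} [AddCommGroup H] [Fintype H] {L : ℕ} {A B C : Fin L → Finset H}

/-- **Translate-coherent first family costs the full volume.** If all `A i` are translates of one
set `A₀`, then `((k, b, c), a₀) ↦ (b − c) + a₀` is injective on `(Σ_k B k × C k) × A₀`
(the `(B,C)`-translation mechanism, STPP instance `(i, k, i)`), so
`(Σ_k |B k||C k|)·|A₀| ≤ |H|` — the full volume bound `L·N·M·N ≤ |H|`.  With `IsSTPP.rotate` the
same holds for the third family (`card_mul_le_of_translate_third`), and §3 is the middle one:
if ANY ONE of the three families is translate-coherent the design certifies only `ω(1,a,1) ≤ 2+a`. -/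
theorem card_mul_le_of_translate_first (h : IsSTPP A B C) (A₀ : Finset H) (x : Fin L → H)
    (hA : ∀ i, A i = A₀.map (addRightEmbedding (x i))) :
    (∑ k, (B k).card * (C k).card) * A₀.card ≤ Fintype.card H := by
  let S : Finset ((Σ _ : Fin L, H × H) × H) := (Finset.univ.sigma fun k => B k ×ˢ C k) ×ˢ A₀
  have hmemA : ∀ i, ∀ a₀ ∈ A₀, a₀ + x i ∈ A i := fun i a₀ ha₀ => by
    rw [hA i]; exact mem_map_of_mem _ ha₀
  have hinj : Set.InjOn (fun q : (Σ _ : Fin L, H × H) × H => (q.1.2.1 - q.1.2.2) + q.2) ↑S := by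
    rintro ⟨⟨k, b, c⟩, a₀⟩ hq ⟨⟨i, b', c'⟩, a₀'⟩ hq' (he : (b - c) + a₀ = (b' - c') + a₀')
    simp only [S, coe_product, coe_sigma, Set.mem_prod, Set.mem_sigma_iff, coe_univ,
      Set.mem_univ, true_and, mem_coe] at hq hq'
    have e2 : ((a₀ + x i) - (a₀' + x i)) + (b - b') + (c' - c) =
        ((b - c) + a₀) - ((b' - c') + a₀') := by abel
    have key := h i k i (a₀' + x i) (hmemA i _ hq'.2) (a₀ + x i) (hmemA i _ hq.2) b' hq'.1.1
      b hq.1.1 c hq.1.2 c' hq'.1.2 (by rw [e2, he, sub_self])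
    obtain ⟨rfl, -, h1, h2, h3⟩ := key
    have h1' : a₀ = a₀' := (add_right_cancel h1).symm
    subst h1'; subst h2; subst h3
    rfl
  have hS : S.card = (∑ k, (B k).card * (C k).card) * A₀.card := by
    simp only [S, card_product, card_sigma]
  rw [← hS]
  exact le_trans (card_le_card_of_injOn _ (fun _ _ => mem_univ _) hinj) (card_univ (α := H)).le

/-- The same for the third family, by the cyclic symmetry `IsSTPP.rotate`. -/
theorem card_mul_le_of_translate_third (h : IsSTPP A B C) (C₀ : Finset H) (x : Fin L → H)
    (hC : ∀ i, C i = C₀.map (addRightEmbedding (x i))) :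
    (∑ k, (A k).card * (B k).card) * C₀.card ≤ Fintype.card H :=
  card_mul_le_of_translate_first h.rotate.rotate C₀ x hC

/-- NATURAL STRENGTHENING: the crux with a translate-coherent FIRST family `A i = A₀ + x i`
(middle and third families arbitrary). -/
def BoundedExponentThirdTranslateA : Prop :=
  ∃ ℓ : ℕ, ∀ η : ℝ, 0 < η → ∃ (H : Type) (_ : AddCommGroup H) (_ : Fintype H) (L N M : ℕ)
    (A B C : Fin L → Finset H) (A₀ : Finset H) (x : Fin L → H),
    (∀ i, A i = A₀.map (addRightEmbedding (x i))) ∧ AddMonoid.exponent H ≤ ℓ ∧ IsSTPP A B C ∧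
    (∀ i, (A i).card = N ∧ (B i).card = M ∧ (C i).card = N) ∧ 2 ≤ N ∧
    (N : ℝ) ^ (1 / 3 : ℝ) ≤ M ∧ (Fintype.card H : ℝ) ≤ L * (N : ℝ) ^ (2 + η)

/-- It is a strengthening of the crux. -/
theorem translateA_imp : BoundedExponentThirdTranslateA → BoundedExponentThird := by
  rintro ⟨ℓ, h⟩
  refine ⟨ℓ, fun η hη => ?_⟩
  obtain ⟨H, i1, i2, L, N, M, A, B, C, -, -, -, rest⟩ := h η hη
  exact ⟨H, i1, i2, L, N, M, A, B, C, rest⟩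

/-- **Refuted strengthening:** one translate-coherent outer family gives `L N² M ≤ |H|`, hence no
two-leg slack below `N^{1/3}`.  Together with §3 (middle) and `card_mul_le_of_translate_third`:
in a witness NONE of the three families can consist of translates of a single set. -/
theorem not_BoundedExponentThirdTranslateA : ¬ BoundedExponentThirdTranslateA := by
  rintro ⟨ℓ, h⟩
  obtain ⟨H, i1, i2, L, N, M, A, B, C, A₀, x, hAx, -, hS, hc, hN, hM, hH⟩ :=
    h (1 / 6) (by norm_num)
  classical
  have hL : 0 < L := blocks_pos hH
  have hA₀c : A₀.card = N := by
    rw [← (hc ⟨0, hL⟩).1, hAx, card_map]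
  have key := card_mul_le_of_translate_first hS A₀ x hAx
  simp only [hc, sum_const, card_univ, Fintype.card_fin, smul_eq_mul, hA₀c] at key
  exact false_of_volume_bound hL hN hM
    (by simpa [mul_comm, mul_assoc, mul_left_comm] using key) hH

end TranslateOuter

end Summit.MatrixMultiplication.MatrixMultiplication.Theorems.BoundedExponentThird.Negative
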